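import Summits.MatrixMultiplication.MatrixMultiplication.Theorems.AbelianSTPPCensusTC2StatRows

/-!
# T_C static certificate, range `2881 … 3003` (k-member tree): domination packaged and the tree's helper facts

Cell mm-stpp (rung F-M1), tier T_C = «beat `2.4`»; checker `AbelianSTPPCensusTC2StatDefs.lean`, part 1 of the data facts `AbelianSTPPCensusTC2StatRows.lean`.
Theory g12's `AbelianSTPPCensusTAStatDRows.lean` §«Domination, packaged» at the universe `3003` (`mono_P_lev` / `mono_P_bkt` / `mono_W_lev`, `dominated` — here for
every `t* ≤ 219`), plus the member-level facts the k-member tree's row hypotheses (`TAStatKM.Hyps`) are assembled from in `AbelianSTPPCensusTC2StatSound.lean`: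
`vol_le_of_small`, `dominatedAt` (domination of a sorted shape at a GIVEN bucket `j` with `t ≤ TB[j+1] − 1`), `mem_m2l` (bucket-list membership), `budget_of_sorted`
(the Grynkiewicz budget from a source member given by its sorted form, via `TAStat.grynkiewicz_budget'_A/B/C`).
WHAT THIS IS NOT: arithmetic about the checker only; no statement about STPP families or `ω`.
-/

set_option linter.dupNamespace false
set_option autoImplicit false

namespace Summit.MatrixMultiplication.MatrixMultiplication.Theorems.TC2Stat

open TECert (tableOK vol us tableOK_iff)
open ShapeCert (gainOfTCY D)
open TC2StatData (E VL TB nl nb)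
open TAStat (tm Entry e0 domP leP leW tm_sorted getD_drop_add grynkiewicz_budget'_A grynkiewicz_budget'_B grynkiewicz_budget'_C)

/-! ## Domination, packaged -/

/-- vM fraction transfer along levels: `leP (ent i j) (ent i' j)` for `i ≤ i' < nl`, `j < nb`. [bookkeeping] -/
theorem mono_P_lev (hmono : TC2Stat.monoOK TC2StatData.nl TC2StatData.nb = true) {i i' j : ℕ} (hii : i ≤ i') (hi' : i' < nl) (hj : j < nb) :
    (TC2Stat.ent i j).1 * (TC2Stat.ent i' j).2.1 ≤ (TC2Stat.ent i' j).1 * (TC2Stat.ent i j).2.1 ∧ 1 ≤ (TC2Stat.ent i' j).2.1 := by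
  have hrow : ∀ i < nl, ∀ j < nb, 1 ≤ (ent i j).2.1 ∧ 1 ≤ (ent i j).2.2.2 ∧
      (i + 1 < nl → leP (ent i j) (ent (i + 1) j) = true ∧ leW (ent i j) (ent (i + 1) j) = true) ∧
      (j + 1 < nb → leP (ent i j) (ent i (j + 1)) = true) := by
    intro i hi j hj
    simp only [monoOK, Bool.and_eq_true, List.all_eq_true, List.mem_range, Nat.beq_eq, Nat.ble_eq, Bool.or_eq_true] at hmono
    obtain ⟨⟨-, h2⟩, -⟩ := hmono
    obtain ⟨-, h3⟩ := h2 i hi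
    obtain ⟨⟨⟨hp, hw⟩, hi1⟩, hj1⟩ := h3 j hj
    refine ⟨hp, hw, fun hlt => ?_, fun hlt => ?_⟩
    · rcases hi1 with hge | hh
      · omega
      · exact hh
    · rcases hj1 with hge | hh
      · omega
      · exact hh
  induction i', hii using Nat.le_induction with
  | base => exact ⟨by rw [Nat.mul_comm], (hrow i hi' j hj).1⟩
  | succ n hn ih =>
    obtain ⟨h1, hp⟩ := ih (by omega)
    have hstep := ((hrow n (by omega) j hj).2.2.1 hi').1
    simp only [leP, Nat.ble_eq] at hstep
    refine ⟨?_, (hrow (n + 1) hi' j hj).1⟩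
    have key : (ent i j).1 * (ent (n + 1) j).2.1 * (ent n j).2.1 ≤ (ent (n + 1) j).1 * (ent i j).2.1 * (ent n j).2.1 := by
      calc (ent i j).1 * (ent (n + 1) j).2.1 * (ent n j).2.1 = (ent i j).1 * (ent n j).2.1 * (ent (n + 1) j).2.1 := by ring
        _ ≤ (ent n j).1 * (ent i j).2.1 * (ent (n + 1) j).2.1 := Nat.mul_le_mul_right _ h1
        _ = (ent n j).1 * (ent (n + 1) j).2.1 * (ent i j).2.1 := by ring
        _ ≤ (ent (n + 1) j).1 * (ent n j).2.1 * (ent i j).2.1 := Nat.mul_le_mul_right _ hstep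
        _ = (ent (n + 1) j).1 * (ent i j).2.1 * (ent n j).2.1 := by ring
    exact Nat.le_of_mul_le_mul_right key hp

/-- vM fraction transfer along buckets: `leP (ent i j) (ent i j')` for `j ≤ j' < nb`, `i < nl`. [bookkeeping] -/
theorem mono_P_bkt (hmono : TC2Stat.monoOK TC2StatData.nl TC2StatData.nb = true) {i j j' : ℕ} (hjj : j ≤ j') (hj' : j' < nb) (hi : i < nl) :
    (TC2Stat.ent i j).1 * (TC2Stat.ent i j').2.1 ≤ (TC2Stat.ent i j').1 * (TC2Stat.ent i j).2.1 ∧ 1 ≤ (TC2Stat.ent i j').2.1 := by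
  have hrow : ∀ j < nb, 1 ≤ (ent i j).2.1 ∧ (j + 1 < nb → leP (ent i j) (ent i (j + 1)) = true) := by
    intro j hj
    simp only [monoOK, Bool.and_eq_true, List.all_eq_true, List.mem_range, Nat.beq_eq, Nat.ble_eq, Bool.or_eq_true] at hmono
    obtain ⟨⟨-, h2⟩, -⟩ := hmono
    obtain ⟨-, h3⟩ := h2 i hi
    obtain ⟨⟨⟨hp, -⟩, -⟩, hj1⟩ := h3 j hj
    refine ⟨hp, fun hlt => ?_⟩
    rcases hj1 with hge | hh
    · omega
    · exact hh
  induction j', hjj using Nat.le_induction with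
  | base => exact ⟨by rw [Nat.mul_comm], (hrow j hj').1⟩
  | succ n hn ih =>
    obtain ⟨h1, hp⟩ := ih (by omega)
    have hstep := (hrow n (by omega)).2 hj'
    simp only [leP, Nat.ble_eq] at hstep
    refine ⟨?_, (hrow (n + 1) hj').1⟩
    have key : (ent i j).1 * (ent i (n + 1)).2.1 * (ent i n).2.1 ≤ (ent i (n + 1)).1 * (ent i j).2.1 * (ent i n).2.1 := by
      calc (ent i j).1 * (ent i (n + 1)).2.1 * (ent i n).2.1 = (ent i j).1 * (ent i n).2.1 * (ent i (n + 1)).2.1 := by ring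
        _ ≤ (ent i n).1 * (ent i j).2.1 * (ent i (n + 1)).2.1 := Nat.mul_le_mul_right _ h1
        _ = (ent i n).1 * (ent i (n + 1)).2.1 * (ent i j).2.1 := by ring
        _ ≤ (ent i (n + 1)).1 * (ent i n).2.1 * (ent i j).2.1 := Nat.mul_le_mul_right _ hstep
        _ = (ent i (n + 1)).1 * (ent i j).2.1 * (ent i n).2.1 := by ring
    exact Nat.le_of_mul_le_mul_right key hp

/-- U11-G fraction transfer along levels: `leW (ent i j) (ent i' j)` for `i ≤ i' < nl`, `j < nb`. [bookkeeping] -/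
theorem mono_W_lev (hmono : TC2Stat.monoOK TC2StatData.nl TC2StatData.nb = true) {i i' j : ℕ} (hii : i ≤ i') (hi' : i' < nl) (hj : j < nb) :
    (TC2Stat.ent i j).2.2.1 * (TC2Stat.ent i' j).2.2.2 ≤ (TC2Stat.ent i' j).2.2.1 * (TC2Stat.ent i j).2.2.2 ∧ 1 ≤ (TC2Stat.ent i' j).2.2.2 := by
  have hrow : ∀ i < nl, 1 ≤ (ent i j).2.2.2 ∧ (i + 1 < nl → leW (ent i j) (ent (i + 1) j) = true) := by
    intro i hi
    simp only [monoOK, Bool.and_eq_true, List.all_eq_true, List.mem_range, Nat.beq_eq, Nat.ble_eq, Bool.or_eq_true] at hmono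
    obtain ⟨⟨-, h2⟩, -⟩ := hmono
    obtain ⟨-, h3⟩ := h2 i hi
    obtain ⟨⟨⟨-, hw⟩, hi1⟩, -⟩ := h3 j hj
    refine ⟨hw, fun hlt => ?_⟩
    rcases hi1 with hge | hh
    · omega
    · exact hh.2
  induction i', hii using Nat.le_induction with
  | base => exact ⟨by rw [Nat.mul_comm], (hrow i hi').1⟩
  | succ n hn ih =>
    obtain ⟨h1, hp⟩ := ih (by omega)
    have hstep := (hrow n (by omega)).2 hi'
    simp only [leW, Nat.ble_eq] at hstep
    refine ⟨?_, (hrow (n + 1) hi').1⟩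
    have key : (ent i j).2.2.1 * (ent (n + 1) j).2.2.2 * (ent n j).2.2.2 ≤ (ent (n + 1) j).2.2.1 * (ent i j).2.2.2 * (ent n j).2.2.2 := by
      calc (ent i j).2.2.1 * (ent (n + 1) j).2.2.2 * (ent n j).2.2.2
          = (ent i j).2.2.1 * (ent n j).2.2.2 * (ent (n + 1) j).2.2.2 := by ring
        _ ≤ (ent n j).2.2.1 * (ent i j).2.2.2 * (ent (n + 1) j).2.2.2 := Nat.mul_le_mul_right _ h1
        _ = (ent n j).2.2.1 * (ent (n + 1) j).2.2.2 * (ent i j).2.2.2 := by ring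
        _ ≤ (ent (n + 1) j).2.2.1 * (ent n j).2.2.2 * (ent i j).2.2.2 := Nat.mul_le_mul_right _ hstep
        _ = (ent (n + 1) j).2.2.1 * (ent i j).2.2.2 * (ent n j).2.2.2 := by ring
    exact Nat.le_of_mul_le_mul_right key hp

/-- **Domination, packaged.**  With the table facts and the domination of every sorted candidate established (`monoOK`, `domV` on all volumes
`1 … Mtop`): a sorted candidate shape `x` of volume `≤ Vl ≤ Mtop` with `tm x ≤ t*` (`1 ≤ t* ≤ 219`) is dominated by the entry
`e = ent (levOf Vl) (bucketOf t*)` read at `t′ = tp (bucketOf t*)`: `g(vol x)·pP ≤ gP·us x`, `vol x < t′·us x`, `g(vol x)·wW ≤ gW·(t′·us x − vol x)`,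
with `pP, wW ≥ 1`. [original] -/
theorem dominated (hmono : TC2Stat.monoOK TC2StatData.nl TC2StatData.nb = true)
    (hdom : ∀ V, 1 ≤ V → V ≤ 3003 → ∀ x ∈ TC2Stat.triplesS V, TC2Stat.domX V (gainOfTCY V) x = true)
    {x : ℕ × ℕ × ℕ} (hx : TC2Stat.SCand x) {Vl ts : ℕ} (hVl : Vl ≤ 3003) (hxV : vol x ≤ Vl) (hts1 : 1 ≤ ts) (hts : ts ≤ 219)
    (hxt : tm x ≤ ts) :
    let e := ent (levOf Vl) (bucketOf ts)
    1 ≤ e.2.1 ∧ 1 ≤ e.2.2.2 ∧ gainOfTCY (vol x) * e.2.1 ≤ e.1 * us x ∧ vol x < tp (bucketOf ts) * us x ∧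
      gainOfTCY (vol x) * e.2.2.2 ≤ e.2.2.1 * (tp (bucketOf ts) * us x - vol x) := by
  intro e
  obtain ⟨a, b, c⟩ := x
  obtain ⟨ha, hab, hbc, ht⟩ := hx
  simp only at ha hab hbc ht
  have hvol : vol (a, b, c) = a * b * c := rfl
  have hV1 : 1 ≤ a * b * c := Nat.mul_pos (Nat.mul_pos ha (le_trans ha hab)) (le_trans (le_trans ha hab) hbc)
  have hVx : a * b * c ≤ 3003 := by rw [← hvol]; exact hxV.trans hVl
  have hmem : (a, b, c) ∈ triplesS (a * b * c) := mem_triplesS ⟨ha, hab, hbc, ht⟩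
  have hd := hdom (a * b * c) hV1 hVx _ hmem
  have htm : tm (a, b, c) = a * b := tm_sorted hab hbc
  set i₀ := levOf (a * b * c) with hi₀
  set j₀ := bucketOf (a * b) with hj₀
  set i := levOf Vl with hi
  set j := bucketOf ts with hj
  have hi₀i : i₀ ≤ i := levOf_mono (by rw [← hvol]; exact hxV) hVl
  have hinl : i < nl := (levOf_spec Vl hVl).1
  have hi₀nl : i₀ < nl := (levOf_spec _ hVx).1
  have htm1 : 1 ≤ a * b := Nat.mul_pos ha (le_trans ha hab)
  have htmts : a * b ≤ ts := by rw [← htm]; exact hxt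
  have hj₀j : j₀ ≤ j := bucketOf_monoD htmts (by omega)
  have hjs := bucketOf_specD (t := ts) (by omega) hts1
  have hjnb : j < nb := hjs.1
  have hj₀s := bucketOf_specD (t := a * b) (by omega) htm1
  simp only [domX, Bool.and_eq_true, htm] at hd
  obtain ⟨hP, hW⟩ := hd
  simp only [domP, Nat.ble_eq] at hP
  have hlen : (E.getD i₀ []).length = nb := row_length i₀ hi₀nl
  have hk : j - j₀ < ((E.getD i₀ []).drop j₀).length := by rw [List.length_drop, hlen]; omega
  have hW' := domWrow_sound _ _ _ _ _ hW (j - j₀) hk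
  rw [getD_drop_add, show j₀ + (j - j₀) = j by omega] at hW'
  change gainOfTCY (a * b * c) * (ent i₀ j₀).2.1 ≤ (ent i₀ j₀).1 * us (a, b, c) at hP
  change a * b * c < tp j * us (a, b, c) ∧ gainOfTCY (a * b * c) * (ent i₀ j).2.2.2 ≤ (ent i₀ j).2.2.1 * (tp j * us (a, b, c) - a * b * c)
    at hW'
  obtain ⟨hlt, hWd⟩ := hW'
  obtain ⟨hPj, hp1⟩ := mono_P_bkt hmono hj₀j hjnb hi₀nl
  obtain ⟨hPi, hp2⟩ := mono_P_lev hmono hi₀i hinl hjnb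
  obtain ⟨hWi, hw2⟩ := mono_W_lev hmono hi₀i hinl hjnb
  have hp0 : 1 ≤ (ent i₀ j₀).2.1 := (mono_P_bkt hmono le_rfl (by omega) hi₀nl).2
  have hw0 : 1 ≤ (ent i₀ j).2.2.2 := (mono_W_lev hmono le_rfl hi₀nl hjnb).2
  set g := gainOfTCY (a * b * c)
  set u := us (a, b, c)
  have hP1 : g * (ent i₀ j).2.1 ≤ (ent i₀ j).1 * u := by
    have key : g * (ent i₀ j).2.1 * (ent i₀ j₀).2.1 ≤ (ent i₀ j).1 * u * (ent i₀ j₀).2.1 := by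
      calc g * (ent i₀ j).2.1 * (ent i₀ j₀).2.1 = g * (ent i₀ j₀).2.1 * (ent i₀ j).2.1 := by ring
        _ ≤ (ent i₀ j₀).1 * u * (ent i₀ j).2.1 := Nat.mul_le_mul_right _ hP
        _ = (ent i₀ j₀).1 * (ent i₀ j).2.1 * u := by ring
        _ ≤ (ent i₀ j).1 * (ent i₀ j₀).2.1 * u := Nat.mul_le_mul_right _ hPj
        _ = (ent i₀ j).1 * u * (ent i₀ j₀).2.1 := by ring
    exact Nat.le_of_mul_le_mul_right key hp0
  have hP2 : g * (ent i j).2.1 ≤ (ent i j).1 * u := by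
    have key : g * (ent i j).2.1 * (ent i₀ j).2.1 ≤ (ent i j).1 * u * (ent i₀ j).2.1 := by
      calc g * (ent i j).2.1 * (ent i₀ j).2.1 = g * (ent i₀ j).2.1 * (ent i j).2.1 := by ring
        _ ≤ (ent i₀ j).1 * u * (ent i j).2.1 := Nat.mul_le_mul_right _ hP1
        _ = (ent i₀ j).1 * (ent i j).2.1 * u := by ring
        _ ≤ (ent i j).1 * (ent i₀ j).2.1 * u := Nat.mul_le_mul_right _ hPi
        _ = (ent i j).1 * u * (ent i₀ j).2.1 := by ring
    exact Nat.le_of_mul_le_mul_right key hp1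
  have hW2 : g * (ent i j).2.2.2 ≤ (ent i j).2.2.1 * (tp j * u - a * b * c) := by
    have key : g * (ent i j).2.2.2 * (ent i₀ j).2.2.2 ≤ (ent i j).2.2.1 * (tp j * u - a * b * c) * (ent i₀ j).2.2.2 := by
      calc g * (ent i j).2.2.2 * (ent i₀ j).2.2.2 = g * (ent i₀ j).2.2.2 * (ent i j).2.2.2 := by ring
        _ ≤ (ent i₀ j).2.2.1 * (tp j * u - a * b * c) * (ent i j).2.2.2 := Nat.mul_le_mul_right _ hWd
        _ = (ent i₀ j).2.2.1 * (ent i j).2.2.2 * (tp j * u - a * b * c) := by ring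
        _ ≤ (ent i j).2.2.1 * (ent i₀ j).2.2.2 * (tp j * u - a * b * c) := Nat.mul_le_mul_right _ hWi
        _ = (ent i j).2.2.1 * (tp j * u - a * b * c) * (ent i₀ j).2.2.2 := by ring
    exact Nat.le_of_mul_le_mul_right key hw0
  exact ⟨hp2, hw2, hP2, hlt, hW2⟩


/-! ## Helper facts for the tree's row hypotheses -/

/-- a sorted shape with smallest size `≤ t` has volume `≤ t·(pair-product sum)` [bookkeeping] -/
theorem vol_le_of_small {x : ℕ × ℕ × ℕ} (hx : TC2Stat.SCand x) {t : ℕ} (h : x.1 ≤ t) : vol x ≤ t * us x := by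
  obtain ⟨-, h12, h23, -⟩ := hx
  simp only [vol, us, TECert.uu, TECert.vv, TECert.ww]
  calc x.1 * x.2.1 * x.2.2 = x.1 * (x.2.1 * x.2.2) := by ring
    _ ≤ t * (x.2.1 * x.2.2) := Nat.mul_le_mul_right _ h
    _ ≤ t * (x.1 * x.2.1 + x.2.1 * x.2.2 + x.2.2 * x.1) := Nat.mul_le_mul_left _ (by omega)

/-- **Domination at a given bucket.**  A sorted candidate shape `x` of volume `≤ Vl ≤ Mtop` with `tm x ≤ TB[j+1] − 1`, `j < nb`, is dominated by the row entry
`rowOf Vl j` read at `TB[j]` (vM fraction; genuine U11-G weight; U11-G fraction). [original] -/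
theorem dominatedAt (hmono : TC2Stat.monoOK TC2StatData.nl TC2StatData.nb = true)
    (hdom : ∀ V, 1 ≤ V → V ≤ 3003 → ∀ x ∈ TC2Stat.triplesS V, TC2Stat.domX V (gainOfTCY V) x = true)
    {x : ℕ × ℕ × ℕ} (hx : TC2Stat.SCand x) {Vl j : ℕ} (hVl : Vl ≤ 3003) (hxV : vol x ≤ Vl) (hj : j < TC2StatData.nb)
    (hxt : tm x ≤ TC2Stat.tb (j + 1) - 1) :
    gainOfTCY (vol x) * (TC2Stat.rowOf Vl j).2.1 ≤ (TC2Stat.rowOf Vl j).1 * us x ∧ vol x < TC2Stat.tb j * us x ∧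
      gainOfTCY (vol x) * (TC2Stat.rowOf Vl j).2.2.2 ≤ (TC2Stat.rowOf Vl j).2.2.1 * (TC2Stat.tb j * us x - vol x) := by
  have hs := tb_step j hj
  have hp0 := tb_pos j hj.le
  have h86 : TC2Stat.tb (j + 1) ≤ TC2Stat.tb TC2StatData.nb := tb_mono (by omega) le_rfl
  rw [tb_nb.2] at h86
  have hb := bucketOf_tb_pred j hj
  have hd := dominated hmono hdom hx hVl hxV (by omega) (by omega) hxt
  rw [hb] at hd
  exact ⟨hd.2.2.1, hd.2.2.2.1, hd.2.2.2.2⟩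

/-- completeness of the bucket lists, member form: a sorted candidate shape with `a·b` in bucket `j < nb` lies in `M2[j]` [bookkeeping] -/
theorem mem_m2l
    (hm2 : ∀ V, 1 ≤ V → V ≤ 3003 → ∀ x ∈ TC2Stat.triplesS V,
      TC2Stat.m2f (TC2Stat.bucketOf (x.1 * x.2.1)) = true → x ∈ TC2Stat.m2l (TC2Stat.bucketOf (x.1 * x.2.1)))
    {x : ℕ × ℕ × ℕ} (hx : TC2Stat.SCand x) (hV1 : 1 ≤ vol x) (hV : vol x ≤ 3003) {j : ℕ} (hj : j < TC2StatData.nb)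
    (h1 : TC2Stat.tb j ≤ x.1 * x.2.1) (h2 : x.1 * x.2.1 ≤ TC2Stat.tb (j + 1) - 1) : x ∈ TC2Stat.m2l j := by
  have hmem : x ∈ TC2Stat.triplesS (vol x) := by
    have := mem_triplesS (a := x.1) (b := x.2.1) (c := x.2.2) hx
    simpa only [vol] using this
  have hbq : TC2Stat.bucketOf (x.1 * x.2.1) = j := bucketOf_eq_of_mem hj h1 h2
  have hc := hm2 (vol x) hV1 hV x hmem
  rw [hbq] at hc
  exact hc (m2f_all j hj)

end Summit.MatrixMultiplication.MatrixMultiplication.Theorems.TC2Stat
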